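import Mathlib
import Literature.Computability.Complexity.CookBridges
import Literature.Computability.Complexity.KarpCliqueNP
import Literature.Computability.Complexity.CircuitClassesUniformProofs
import Literature.Computability.Complexity.CircuitClassesProofs
import Literature.Computability.Complexity.Williams2014
import Summits.PneNP.PneNP.Theses.ConvexRankGates

/-!
# Route ConvexRankGates — support item `CliqueBridge` (stmt-PneNP-10683)

`Summit.PneNP.PneNP.Theses.ConvexRankGates.CliqueBridge`: if for some `δ ∈ (0, 1/2)` the clique
functions `CLIQUE(m, ⌈m^δ⌉)` of the edge indicators of `K_m` (written inline in the route file,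
`fun x => decide (¬ (fromEdgeSet {e | x e}).CliqueFree ⌈m^δ⌉₊)`) have, for every exponent `c` and
all large `m`, no `B₂`-circuit with at most `m ^ c` gates, then Cook's `P ≠ NP` (the summit
statement `PneNP`). This is the third hypothesis of the route's deciding theorem `closes`.

Proof (Karp 1972 + the folklore input restriction, Arora–Barak 2009, §6.1 / Thm. 6.6), from PROVED
facts of the tree only:
* if Cook's `P ≠ NP` fails then `CLIQUE ∈ Classes.P` (`CLIQUE_mem_NP`, `KarpCliqueNP.lean`; model
  bridges `CookBridges.np_bool_eq`, `p_bool_eq` of the conjecture-free module `CookBridges.lean`),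
  hence `CLIQUE ∈ P/poly` (`P_subset_PPoly_holds`): a `B₂`-circuit family of size `q(N)` deciding
  `CLIQUE`;
* `exists_symbolic_code`: for fixed `m, k` the code word of the instance `(⟨m, G_x⟩, k)` under
  `encodingGraph.pairBool encodingNatBool` is ONE list of symbols (edge variable or constant bit)
  with the edge indicators `x` substituted (`CliqueNP.instEnc_encode_eq`, `CliqueNP.adjBits`);
* hard-wiring that list into the circuit at the code length `N ≤ 3m²` (`Circuit.exists_hardwire`,
  two extra constant gates) gives a `B₂`-circuit on the edges of `K_m` with `≤ q(N) + 2 ≤ m^(3d+1)`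
  gates computing `CLIQUE(m, ⌈m^δ⌉)` (`CircuitFamily.Decides.eval_eq`), contradicting the
  hypothesis at the exponent `3d + 1` (`CookBridges.exists_pow_dominates`).
-/

namespace Summit.PneNP.PneNP.Theorems

open Literature.Computability.Complexity
open _root_.Computability

/-- Adjacency of the graph read off an edge-indicator vector `x` of `K_m`: `i ~ j` iff `i ≠ j`
and the bit of the edge `{i, j}` is set. [folklore] -/
theorem fromEdgeSet_indicator_adj {m : ℕ} (x : (⊤ : SimpleGraph (Fin m)).edgeSet → Bool)
    (i j : Fin m) :
    (SimpleGraph.fromEdgeSet {e : Sym2 (Fin m) |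
        ∃ h : e ∈ (⊤ : SimpleGraph (Fin m)).edgeSet, x ⟨e, h⟩ = true}).Adj i j ↔
      ∃ h : i ≠ j,
        x ⟨s(i, j), (SimpleGraph.mem_edgeSet ⊤).2 ((SimpleGraph.top_adj i j).2 h)⟩ = true := by
  rw [SimpleGraph.fromEdgeSet_adj]
  constructor
  · rintro ⟨⟨h, hx⟩, hij⟩
    exact ⟨hij, hx⟩
  · rintro ⟨hij, hx⟩
    exact ⟨⟨_, hx⟩, hij⟩

/-- **Symbolic code word.** For fixed `m, k` there is ONE list `S` of symbols — each either an
edge variable of `K_m` or a constant bit — such that for every edge-indicator vector `x` the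
code of the `CLIQUE` instance `(⟨m, G_x⟩, k)` (`G_x` the graph with edge set read off `x`) is
`S` with the variables substituted: the adjacency bits are the edge variables (diagonal `0`),
everything else (the numerals of `m` and `k`, separators, doubling) is fixed.
[cite: AroraBarak2009, §0.1 (adjacency-matrix representation)] -/
theorem exists_symbolic_code (m k : ℕ) :
    ∃ S : List ((⊤ : SimpleGraph (Fin m)).edgeSet ⊕ Bool),
      ∀ x : (⊤ : SimpleGraph (Fin m)).edgeSet → Bool,
        CliqueNP.instEnc.encode
            (⟨m, SimpleGraph.fromEdgeSet {e : Sym2 (Fin m) |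
              ∃ h : e ∈ (⊤ : SimpleGraph (Fin m)).edgeSet, x ⟨e, h⟩ = true}⟩, k) =
          S.map (Sum.elim x id) := by
  classical
  let σ₀ : Fin (m * m) → (⊤ : SimpleGraph (Fin m)).edgeSet ⊕ Bool := fun t =>
    if h : t.divNat = t.modNat then Sum.inr false
    else Sum.inl ⟨s(t.divNat, t.modNat),
      (SimpleGraph.mem_edgeSet ⊤).2 ((SimpleGraph.top_adj _ _).2 h)⟩
  let dbl : List ((⊤ : SimpleGraph (Fin m)).edgeSet ⊕ Bool) →
      List ((⊤ : SimpleGraph (Fin m)).edgeSet ⊕ Bool) := fun L => L.flatMap fun s => [s, s]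
  let cst : List Bool → List ((⊤ : SimpleGraph (Fin m)).edgeSet ⊕ Bool) := fun l =>
    l.map Sum.inr
  refine ⟨dbl (dbl (cst (encodeNat m)) ++ cst [false, true] ++ List.ofFn σ₀) ++
    cst [false, true] ++ cst (encodeNat k), fun x => ?_⟩
  rw [CliqueNP.instEnc_encode_eq]
  have hcst : ∀ l, (cst l).map (Sum.elim x id) = l := fun l => by
    simp [cst, List.map_map]
  have hdbl : ∀ L, (dbl L).map (Sum.elim x id) =
      (L.map (Sum.elim x id)).flatMap fun b => [b, b] := fun L => by
    simp [dbl, List.map_flatMap, List.flatMap_map]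
  have hadj : CliqueNP.adjBits m (SimpleGraph.fromEdgeSet {e : Sym2 (Fin m) |
      ∃ h : e ∈ (⊤ : SimpleGraph (Fin m)).edgeSet, x ⟨e, h⟩ = true}) =
      (List.ofFn σ₀).map (Sum.elim x id) := by
    rw [List.map_ofFn]
    unfold CliqueNP.adjBits
    congr 1
    funext t
    simp only [Function.comp_apply, σ₀]
    by_cases h : t.divNat = t.modNat
    · rw [dif_pos h, h]
      simp
    · rw [dif_neg h]
      simp only [Sum.elim_inl]
      rw [Bool.eq_iff_iff]
      simp only [decide_eq_true_eq]
      rw [fromEdgeSet_indicator_adj]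
      exact ⟨fun ⟨_, hx⟩ => hx, fun hx => ⟨h, hx⟩⟩
  simp only [boolPair, List.map_append, hdbl, hcst, hadj]


/-- `⌈m ^ δ⌉ ≤ m` for `m ≥ 1` and `0 ≤ δ ≤ 1`. [folklore] -/
theorem ceil_rpow_le_self {m : ℕ} (hm : 1 ≤ m) {δ : ℝ} (hδ1 : δ ≤ 1) :
    ⌈(m : ℝ) ^ δ⌉₊ ≤ m := by
  refine Nat.ceil_le.2 ?_
  have h1 : (1 : ℝ) ≤ m := by exact_mod_cast hm
  calc (m : ℝ) ^ δ ≤ (m : ℝ) ^ (1 : ℝ) := Real.rpow_le_rpow_of_exponent_le h1 hδ1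
    _ = m := Real.rpow_one _

/-- **`CliqueBridge` holds** (route `ConvexRankGates`, support item stmt-PneNP-10683): if for some
`δ ∈ (0, 1/2)` the clique functions `CLIQUE(m, ⌈m^δ⌉)` of the edge indicators of `K_m` have, for
every exponent `c` and all large `m`, no `B₂`-circuit with at most `m ^ c` gates, then `P ≠ NP`
(Cook's statement `PneNP`). Proof: if Cook's `P ≠ NP` fails then `CLIQUE ∈ P` (Karp 1972:
`CLIQUE ∈ NP`, `CLIQUE_mem_NP`; model bridges `CookBridges.np_bool_eq`, `p_bool_eq`), hence
`CLIQUE ∈ P/poly` (`P_subset_PPoly_holds`, Arora–Barak 2009, Thm. 6.6): a `B₂`-circuit family of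
size `q(N)`. At the code length `N ≤ 3m²` of the instances `(⟨m, G⟩, ⌈m^δ⌉)` hard-wire every
non-adjacency position of the code word to its constant and every adjacency position to its edge
variable (`exists_symbolic_code`, `Circuit.exists_hardwire`): a `B₂`-circuit on the edges of `K_m`
with `≤ q(N) + 2 ≤ m^(3d+1)` gates computing `CLIQUE(m, ⌈m^δ⌉)` — contradicting the hypothesis at
`c = 3d + 1`.
[cite: AroraBarak2009, §6.1 and Thm. 6.6] [cite: Karp1972, §4 Main Theorem, problem 3] -/
theorem cliqueBridge_proof : Summit.PneNP.PneNP.Theses.ConvexRankGates.CliqueBridge := by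
  rintro ⟨δ, hδ0, hδ1, hlb⟩
  show ∃ L : Language Bool, L ∈ PNPWave0.NP Bool ∧ L ∉ PNPWave0.P Bool
  by_contra hne
  -- `CLIQUE ∈ P ⊆ P/poly`
  have hP : CLIQUE ∈ Classes.P := by
    by_contra hCP
    exact hne ⟨CLIQUE, by rw [CookBridges.np_bool_eq]; exact CLIQUE_mem_NP,
      by rw [p_bool_eq]; exact hCP⟩
  obtain ⟨q, C, hC, hdec⟩ : ∃ q : Polynomial ℕ, ∃ C : CircuitFamily,
      (∀ n, (C n).IsOver B2 ∧ (C n).size ≤ q.eval n) ∧ C.Decides CLIQUE := by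
    simpa [PPoly, SIZE] using P_subset_PPoly_holds hP
  obtain ⟨d, -, hq⟩ := CookBridges.exists_pow_dominates q
  -- a large `m` at which the lower bound with exponent `3d + 1` is in force
  obtain ⟨m, hm, h6⟩ := ((hlb (3 * d + 1)).and (Filter.eventually_ge_atTop 6)).exists
  set k : ℕ := ⌈(m : ℝ) ^ δ⌉₊ with hk
  -- hard-wire the code word of `(⟨m, G_x⟩, k)` into the `P/poly` circuit at its length
  obtain ⟨S, hS⟩ := exists_symbolic_code m k
  obtain ⟨D, hDB, hDsize, -, hDeval⟩ :=
    Circuit.exists_hardwire (B := B2) (ι := (⊤ : SimpleGraph (Fin m)).edgeSet)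
      (by simp [B2, GateFn.or]) (by simp [B2, GateFn.and]) (C S.length) (hC _).1
      (fun p => S.get p)
  refine hm D hDB ?_ ?_
  · -- size bookkeeping: `|D| ≤ q(N) + 2 ≤ N^d + 2 ≤ (3m²)^d + 2 ≤ m^(3d+1)`
    have hlen : S.length =
        2 * (2 * (encodeNat m).length + 2 + m * m) + 2 + (encodeNat k).length := by
      have h := congrArg List.length (hS fun _ => false)
      rw [List.length_map, CliqueNP.instEnc_encode_eq] at h
      simp only [length_boolPair, CliqueNP.length_adjBits] at h
      omega
    have hsz : ∀ n : ℕ, (encodeNat n).length ≤ n := fun n => by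
      rw [TM2Pass.length_encodeNat_eq_size]
      exact Nat.size_le.2 Nat.lt_two_pow_self
    have hmle : (encodeNat m).length ≤ m := hsz m
    have hkm : k ≤ m := ceil_rpow_le_self (by omega) (by linarith)
    have hkle : (encodeNat k).length ≤ m := (hsz k).trans hkm
    have hN : S.length ≤ 3 * m ^ 2 := by rw [hlen]; nlinarith
    have hN2 : 2 ≤ S.length := by rw [hlen]; omega
    have h3m : 1 ≤ m := by omega
    calc D.size ≤ (C S.length).size + 2 := hDsize
      _ ≤ q.eval S.length + 2 := Nat.add_le_add_right (hC S.length).2 2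
      _ ≤ S.length ^ d + 2 := Nat.add_le_add_right (hq _ hN2) 2
      _ ≤ (3 * m ^ 2) ^ d + 2 := Nat.add_le_add_right (Nat.pow_le_pow_left hN d) 2
      _ ≤ m ^ (3 * d) + 2 := by
          have h3 : 3 ^ d ≤ m ^ d := Nat.pow_le_pow_left (by omega) d
          have e1 : (3 * m ^ 2) ^ d = 3 ^ d * m ^ (2 * d) := by rw [mul_pow, ← pow_mul]
          have e2 : m ^ (3 * d) = m ^ d * m ^ (2 * d) := by rw [← pow_add]; ring_nf
          rw [e1, e2]
          exact Nat.add_le_add_right (Nat.mul_le_mul_right _ h3) 2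
      _ ≤ m ^ (3 * d + 1) := by
          rw [pow_succ]
          have h1 : 1 ≤ m ^ (3 * d) := Nat.one_le_pow _ _ (by omega)
          nlinarith
  · -- the hard-wired circuit computes `CLIQUE(m, k)` on the edge indicators of `K_m`
    intro x
    rw [hDeval, hdec.eval_eq]
    have hw : List.ofFn (fun p : Fin S.length => Sum.elim x id (S.get p)) =
        S.map (Sum.elim x id) := by
      simp
    rw [hw, ← hS x]
    have hmem := Computability.Encoding.mem_toLanguage_iff CliqueNP.instEnc cliqueSet
      (⟨m, SimpleGraph.fromEdgeSet {e : Sym2 (Fin m) |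
        ∃ h : e ∈ (⊤ : SimpleGraph (Fin m)).edgeSet, x ⟨e, h⟩ = true}⟩, k)
    change CliqueNP.instEnc.encode _ ∈ CLIQUE ↔ ¬ (SimpleGraph.fromEdgeSet {e : Sym2 (Fin m) |
        ∃ h : e ∈ (⊤ : SimpleGraph (Fin m)).edgeSet, x ⟨e, h⟩ = true}).CliqueFree k at hmem
    dsimp only
    by_cases hcl : (SimpleGraph.fromEdgeSet {e : Sym2 (Fin m) |
        ∃ h : e ∈ (⊤ : SimpleGraph (Fin m)).edgeSet, x ⟨e, h⟩ = true}).CliqueFree k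
    · exact ((Set.notMem_iff_boolIndicator (CLIQUE : Set (List Bool)) _).1
        (fun h => hmem.1 h hcl)).trans (by simp only [hcl, not_true_eq_false, decide_false])
    · exact ((Set.mem_iff_boolIndicator (CLIQUE : Set (List Bool)) _).1 (hmem.2 hcl)).trans
        (by simp only [hcl, not_false_eq_true, decide_true])

end Summit.PneNP.PneNP.Theorems
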